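import Summits.HodgeConjecture.HodgeConjecture.Theses.HeckePrymWeil
import Summits.HodgeConjecture.HodgeConjecture.Theses.AnchorTransport
import Literature.AlgebraicGeometry.Motives.AbelianVarietyProjectiveChart
import Literature.AlgebraicGeometry.HodgeTheory.FermatHypersurfaceReduction
import Literature.AlgebraicGeometry.HodgeTheory.ComplexConjugation
import Literature.AlgebraicGeometry.HodgeTheory.MotivatedClasses

/-!
# `WeilVariationalHodge` (stmt-HodgeConjecture-14497) · Negative · the crux is dominated by the Hodge conjecture

Negative-side knowledge for the crux `HeckePrymWeil.WeilVariationalHodge` (variational Hodge for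
fibrewise-`(M,M)` global classes along smooth projective families of abelian `2M`-folds with
`√-p`-multiplication over a smooth irreducible base), extracted from the standing disprover's work file
`Cruxes/WeilVariationalHodge/Disproof.lean` §1–§2 (refuter-cdisprove-stmt-HodgeConjecture-14497-0,
cycle 1, 2026-08-16). Negative forms only; everything unconditional and `sorry`-free:

* `not_hodgeConjecture_of_not_weilVariationalHodge` : `¬ crux → ¬ HodgeConjecture`. The summit gives
  the crux in two lines using only that each fibre is smooth projective
  (`IsSmoothProjectiveFamily.isSmoothProjective`) and that `W|_{𝒳_s}` is rational of type `(M,M)` at `s`;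
  irreducibility and smoothness of the base, the Weil fibres, the prime `p`, `M ≥ 1` and the anchor
  `s₀` are unused (Charles–Schnell, *Notes on absolute Hodge classes*, arXiv:1101.3647 Cor. 35 / book
  Cor. 11.3.6: "The Hodge conjecture implies the variational Hodge conjecture"). So ANY refutation of the
  crux is a counterexample to the Clay problem as typed.
* `not_variationalHodge_of_not_weilVariationalHodge` : `¬ crux → ¬ AnchorTransport.VariationalHodge`
  (stmt-HodgeConjecture-1076): the crux is the Weil-fibre instance `n := 2M`, `p := M` of the general
  variational crux, so a kill propagates across routes.
* `exists_nonalgebraic_hodgeClass_of_not_weilVariationalHodge` : SHARP FORM — a kill produces a prime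
  `p ≡ 3 (4)`, `p ≥ 7`, an `M ≥ 1`, a complex abelian `2M`-fold `A` with `φ ≫ φ = -(p • 𝟙)` and a
  rational class of Hodge type `(M,M)` on `A` OUTSIDE `algebraicClasses A.X M` (any Hodge class of `A`,
  not necessarily in the Weil eigen-span): the fibre class is moved to `A` along the crux's own iso
  `A.X ≅ 𝒳_s` with the tree's proved `IsRationalClass.map`, `IsOfHodgeType.map_of_iso`,
  `mem_algebraicClasses_map_of_iso`, `map_hom_map_inv_apply`.
* `not_standardConjectureB_of_not_weilVariationalHodge` : granted André's two printed theorems (tree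
  named facts `Andre1996_hodgeClasses_abelianVariety_motivated`, Thm. 0.6.2, and
  `Andre1996_motivatedClasses_le_algebraicClasses_of_standardConjectureB`, §2.1), a kill refutes the
  Lefschetz standard conjecture `B` for some smooth projective complex variety (Charles–Schnell, remark
  after Thm. 36: "the standard conjectures imply the variational Hodge conjecture, see [An]") — the
  barrier `Andre1996_hodgeClassesOnAbelianVarieties_motivated` made concrete for this item.
-/

noncomputable section

set_option linter.dupNamespace false

namespace Summit.HodgeConjecture.HodgeConjecture.Theorems.WeilVariationalHodge.Negative

open CategoryTheory
open Literature.AlgebraicGeometry.Motives Literature.AlgebraicGeometry.HodgeTheory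
open Summit.HodgeConjecture.HodgeConjecture.Theses

/-- **A kill of the crux is a disproof of the Hodge conjecture**: `HodgeConjecture → WeilVariationalHodge`
(apply `HodgeConjectureFor (2M) (fiberOver f s)` to `W|_{𝒳_s}`), contraposed.
[cite: CharlesSchnell2014Notes, Cor. 11.3.6 (arXiv:1101.3647 Cor. 35)] -/
theorem not_hodgeConjecture_of_not_weilVariationalHodge (h : ¬ HeckePrymWeil.WeilVariationalHodge) :
    ¬ _root_.HodgeConjecture :=
  fun hHC => h fun _ _ _ _ M _ _ _ _ hf _ _ _ hW _ _ s =>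
    (hHC (hf.isSmoothProjective s)).2 M _ (hW s).1 (hW s).2

/-- **Kill propagation across routes**: the crux is the Weil-fibre instance of
`AnchorTransport.VariationalHodge` (stmt-HodgeConjecture-1076), contraposed. [folklore] -/
theorem not_variationalHodge_of_not_weilVariationalHodge (h : ¬ HeckePrymWeil.WeilVariationalHodge) :
    ¬ AnchorTransport.VariationalHodge :=
  fun hV => h fun _ _ _ _ M _ _ _ f hf hirr hsm W hW _ hs₀ s => hV f hf hirr hsm M W hW hs₀ s

/-- **Sharp form of a kill**: a refutation of the crux yields an explicit non-algebraic rational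
`(M,M)`-class on a complex abelian `2M`-fold carrying `φ` with `φ ≫ φ = -p` (`p ≡ 3 (4)` prime, `p ≥ 7`,
`M ≥ 1`) — i.e. a counterexample to the Hodge conjecture INSIDE the sector, for an arbitrary Hodge class
of the fibre (not only a Weil-span class). Proof: otherwise transport `W|_{𝒳_s}` to the abelian model
`A'` of the fibre along the given `e : A'.X ≅ 𝒳_s` (rationality and Hodge type are preserved:
`IsRationalClass.map`, `IsOfHodgeType.map_of_iso`), use algebraicity there, and come back along `e⁻¹`
(`mem_algebraicClasses_map_of_iso`, `map_hom_map_inv_apply`; abelian varieties are smooth projective: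
`AbelianVariety.isSmoothProjective_holds`). [folklore] -/
theorem exists_nonalgebraic_hodgeClass_of_not_weilVariationalHodge
    (h : ¬ HeckePrymWeil.WeilVariationalHodge) :
    ∃ p M : ℕ, p.Prime ∧ p % 4 = 3 ∧ 7 ≤ p ∧ 1 ≤ M ∧
      ∃ (A : AbelianVariety ℂ) (φ : A ⟶ A), A.dim = 2 * M ∧ φ ≫ φ = -((p : ℤ) • 𝟙 A) ∧
        ∃ c : complexBetti A.X (2 * M), IsRationalClass c ∧ IsOfHodgeType (2 * M) A.X (2 * M) M M c ∧
          c ∉ algebraicClasses A.X M := by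
  by_contra hne
  apply h
  intro p hp h4 h7 M hM 𝒳 S f hf _ _ W hW hA _ s
  obtain ⟨A', φ', hdim, hφ, ⟨e⟩⟩ := hA s
  have hsp : IsSmoothProjective (2 * M) A'.X := by
    have h' := (AbelianVariety.isSmoothProjective_holds (A := A'))
    rw [AbelianVariety.isSmoothProjective, hdim] at h'
    exact h'
  have hrat : IsRationalClass (complexBetti.map e.hom (2 * M) (complexBetti.map (fiberι f s) (2 * M) W)) :=
    (hW s).1.map _
  have hhodge : IsOfHodgeType (2 * M) A'.X (2 * M) M M
      (complexBetti.map e.hom (2 * M) (complexBetti.map (fiberι f s) (2 * M) W)) :=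
    (hW s).2.map_of_iso e
  have halg : complexBetti.map e.hom (2 * M) (complexBetti.map (fiberι f s) (2 * M) W) ∈
      algebraicClasses A'.X M := by
    by_contra hc
    exact hne ⟨p, M, hp, h4, h7, hM, A', φ', hdim, hφ, _, hrat, hhodge, hc⟩
  have back := mem_algebraicClasses_map_of_iso hsp (hf.isSmoothProjective s) e.symm halg
  have hid : complexBetti.map e.symm.hom (2 * M)
      (complexBetti.map e.hom (2 * M) (complexBetti.map (fiberι f s) (2 * M) W)) =
        complexBetti.map (fiberι f s) (2 * M) W :=
    map_hom_map_inv_apply e.symm (2 * M) _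
  rw [hid] at back
  exact back

/-- **A kill refutes the Lefschetz standard conjecture `B` (modulo André 1996 in print)**: if Hodge
classes on abelian varieties are motivated (Thm. 0.6.2, tree fact) and motivated classes are algebraic
under `B` (§2.1, tree fact), then `B` for all smooth projective complex varieties gives every rational
`(M,M)` class on every abelian variety algebraic, contradicting the sharp form of a kill.
[cite: Andre1996Motifs, Thm. 0.6.2 and §2.1] [cite: CharlesSchnell2014Notes, remark after Thm. 11.3.7] -/
theorem not_standardConjectureB_of_not_weilVariationalHodge
    (hA1 : Andre1996_motivatedClasses_le_algebraicClasses_of_standardConjectureB)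
    (hA2 : Andre1996_hodgeClasses_abelianVariety_motivated)
    (h : ¬ HeckePrymWeil.WeilVariationalHodge) :
    ¬ ∀ (d : ℕ) (Z : SchemeOver ℂ) (η : complexBetti Z 2), IsSmoothProjective d Z →
        StandardConjectureBStar d Z η := by
  intro hB
  obtain ⟨p, M, _, _, _, _, A, φ, hdim, _, c, hrat, hhodge, hc⟩ :=
    exists_nonalgebraic_hodgeClass_of_not_weilVariationalHodge h
  have hsp : IsSmoothProjective A.dim A.X := AbelianVariety.isSmoothProjective_holds (A := A)
  have hhodge' : IsOfHodgeType A.dim A.X (2 * M) M M c := by rw [hdim]; exact hhodge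
  exact hc (hA1 hB hsp M (hA2 A hsp M c hrat hhodge'))

end Summit.HodgeConjecture.HodgeConjecture.Theorems.WeilVariationalHodge.Negative

end
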